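import Summits.QuantumFields.BalabanUV.Beta.GAN24.ExponentialChartBaseJets
import Summits.QuantumFields.BalabanUV.Beta.GAN24.ExponentialChartMixedJets

/-!
# `BalabanUV.Beta.GAN24.ExponentialChartBaseMixedJets` — binder row G-an2-4 ∕ (CONV-C), route R7 «TWO CURRENCIES», PART 266: THE TWO-PARAMETER CHART AT A BASE POINT.  For REAL
# connections `A₀` (base), `A`, `B` (directions) the chart `U_{s,r} = exp(iη(A₀ + sA + rB))` through `U₀ = e^{iηA₀}` has `−w_{s,r} = n − n·e^{θ₀ + θs + φr}`,
# `z_{s,r} = −n²Σ_ν(e^{θ₀+θs+φr} + e^{−θ₀−θs−φr} − 2)` (UNSHIFTED), and the SEPARATE partial jets at the origin that PART 251's `deriv_deriv_inv_readout_two_param` consumes — PART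
# 252's jets TWISTED BY THE BASE PHASE and with a NONZERO zeroth-order part in the first-order letters: `∂_s|₀(−w) = −iA·e^{θ₀ + φr}` (at `r = 0`: `−iA·e^{θ₀}`), mixed
# `−(iA)(iB∕n)e^{θ₀}`; `∂_s|₀z = −n²Σ_ν(θe^{θ₀+φr} − θe^{−θ₀−φr})` (at `r = 0`: `−nΣ_ν(iA_ν)(e^{θ₀,ν} − e^{−θ₀,ν})`, which vanishes only at `A₀ = 0`), mixed
# `−Σ_ν(iA_ν)(iB_ν)(e^{θ₀,ν} + e^{−θ₀,ν})`; at the MATRIX level (NE2's EXACT `covPert_eq` + PART 241's entrywise lift) the hypotheses `h10 ∕ ha ∕ h01 ∕ h11` of PART 251 at the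
# base `D = Δ_a`, `P(s, r) = Δ^{U_{s,r}} − Δ^1` with `P(0, 0) = Δ^{U₀} − Δ^1 ≠ 0` (unit b2b-balaban-gan24-p3, gen 67; v1; generator `HOME/b2b-balaban-gan24-p3/gen67/records/gen/gen266.py`)

NOT IN PRINT; OUR PROOF ([folklore] one- and two-variable calculus BY NAME over PART 245 (`hasDerivAt_const_mul_cexp`, `conj_theta`), PART 241 (`hasDerivAt_Pmodel_curve`,
`hasDerivAt_conjTranspose_Pmodel_curve`, `hasDerivAt_diagonal_curve`), NE2's `covPert_eq`, `connV`, `zT`; Mathlib's `HasDerivAt.cexp ∕ ofReal_comp ∕ fun_sum`, `Complex.exp_conj`;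
[Balaban1985BackgroundPropagators] (3.3) p. 390 and [Balaban1987RG1] (1.20) p. 264 LOCATE the chart; nothing printed is a hypothesis).
HONEST FRAMING (cell contract, verbatim): «discharging `BetaPertH` makes Bałaban's UV stability UNCONDITIONAL — a real constructive-QFT result; it is NOT the
continuum limit and NOT the Clay problem.»  HONEST DEPENDENCY (verbatim): «continuum YM on T⁴ ⇐ BetaPertH ∧ nine spine estimates (0/9 proved); BetaPertH ⇐
(D1) ∧ (D4) ∧ CAP+tail; G-an2-4 gates asym, D1 and NE2/3/4.»

WHAT THIS FILE PROVES (0 sorry, 0 `def`; `U_{s,r} k ν x = exp(I·A₀∕n + (I·A∕n)·s + (I·B∕n)·r)` at level `k`, `A₀, A, B` REAL; `θ₀ = I·A₀∕n`, `θ = I·A∕n`, `φ = I·B∕n`):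
* §1 scalar calculus (`hasDerivAt_const_mul_cexp_add₃_fst ∕ _snd`, `hasDerivAt_const_mul_cexp_base`, `star_conn_expChartAt₂`); §2 `expChartAt₂_swap ∕ _zero_zero`,
  **`connV_expChartAt₂`**, **`zT_expChartAt₂`**, `covPert_expChartAt₂_zero_zero` (the base letter `Δ^{U₀} − Δ^1`);
* §3 the scalar jets **`hasDerivAt_connV_expChartAt₂_fst`**, **`hasDerivAt_mixedJetV_base`**, **`hasDerivAt_zT_expChartAt₂_fst`**, **`hasDerivAt_mixedJetZ_base`**,
  `mixedCurveV_base_zero`, `mixedCurveZ_base_zero`;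
* §4 the letters **`hasDerivAt_covPert_expChartAt₂_fst`** (`h10`), **`hasDerivAt_mixedLetter_base`** (`h11`), **`mixedLetter_base_fst_zero`** (`ha`),
  **`hasDerivAt_covPert_expChartAt₂_snd_zero`** (`h01`).
WHAT IT DOES NOT DO: the backgrounds' constants and the END of the Hessian at `U₀` (next PARTs over PARTs 251 ∕ 264); colour; Bałaban's `−∂P∂*` ∕ `aQ(U)*Q(U)` parts.
SUPPLIER work; NEVER «G-an2-4 closed»; NOT (CONV-C), NOT D1, NOT `BetaPertH`, NOT continuum, NOT Clay.  Records: `HOME/b2b-balaban-gan24-p3/gen67/README.md`.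
-/

noncomputable section

open scoped BigOperators ComplexConjugate Matrix Matrix.Norms.L2Operator
open Filter Topology

namespace Summit.QuantumFields.BalabanUV.Beta.GAN24.ExponentialChartBaseMixedJets

open Literature.MathematicalPhysics.QuantumFieldTheory.Balaban1983to89
open Literature.MathematicalPhysics.QuantumFieldTheory.Balaban1983to89.B5Prop11Plancherel (Tor fine)
open Literature.MathematicalPhysics.QuantumFieldTheory.Balaban1983to89.B5G183RateUnitTower (lev)
open Summit.QuantumFields.BalabanUV.T4Continuum
open Summit.QuantumFields.BalabanUV.T4Continuum.BalabanAveragedTowerUnit (idx)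
open Summit.QuantumFields.BalabanUV.T4Continuum.FirstOrderBackgroundModel (Pmodel)
open Summit.QuantumFields.BalabanUV.T4Continuum.AbelianCovariantLaplacian (covPert connV zT covPert_eq conn zfield negConn tauInv)
open Summit.QuantumFields.BalabanUV.Beta.GAN24.ExponentialChartJets (hasDerivAt_const_mul_cexp conj_theta)
open Summit.QuantumFields.BalabanUV.Beta.GAN24.CouplingCurveTaylor (hasDerivAt_Pmodel_curve hasDerivAt_conjTranspose_Pmodel_curve hasDerivAt_diagonal_curve)

/-! ## §1 Scalar calculus of `(s, r) ↦ c·e^{θ₀ + θs + φr}` -/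

section Scalar

/-- `∂_s[c·e^{θ₀ + θs + φr}] = cθ·e^{θ₀ + θs + φr}`. [folklore] -/
theorem hasDerivAt_const_mul_cexp_add₃_fst (c θ₀ θ φ : ℂ) (r s : ℝ) :
    HasDerivAt (fun v : ℝ => c * Complex.exp (θ₀ + θ * (v : ℂ) + φ * (r : ℂ))) (c * θ * Complex.exp (θ₀ + θ * (s : ℂ) + φ * (r : ℂ))) s := by
  have hθ : HasDerivAt (fun v : ℝ => θ₀ + θ * (v : ℂ) + φ * (r : ℂ)) θ s := by
    simpa using ((((hasDerivAt_id s).ofReal_comp).const_mul θ).const_add θ₀).add_const (φ * (r : ℂ))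
  have h := (hθ.cexp).const_mul c
  refine h.congr_deriv ?_
  ring

/-- `∂_s[e^{θ₀ + θs + φr}] = θ·e^{θ₀ + θs + φr}`. [folklore] -/
theorem hasDerivAt_cexp_add₃_fst (θ₀ θ φ : ℂ) (r s : ℝ) :
    HasDerivAt (fun v : ℝ => Complex.exp (θ₀ + θ * (v : ℂ) + φ * (r : ℂ))) (θ * Complex.exp (θ₀ + θ * (s : ℂ) + φ * (r : ℂ))) s := by
  have h := hasDerivAt_const_mul_cexp_add₃_fst 1 θ₀ θ φ r s
  simp only [one_mul] at h
  exact h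

/-- `∂_r[c·e^{θ₀ + φr}] = cφ·e^{θ₀ + φr}`. [folklore] -/
theorem hasDerivAt_const_mul_cexp_base (c θ₀ φ : ℂ) (r : ℝ) :
    HasDerivAt (fun v : ℝ => c * Complex.exp (θ₀ + φ * (v : ℂ))) (c * φ * Complex.exp (θ₀ + φ * (r : ℂ))) r := by
  have hφ : HasDerivAt (fun v : ℝ => θ₀ + φ * (v : ℂ)) φ r := by
    simpa using (((hasDerivAt_id r).ofReal_comp).const_mul φ).const_add θ₀
  have h := (hφ.cexp).const_mul c
  refine h.congr_deriv ?_
  ring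

/-- `e^{−p−qz−wy}·e^{p+qz+wy} = 1`. [folklore] -/
theorem cexp_neg_add₃_mul_cexp (p q w z y : ℂ) : Complex.exp (-p + -q * z + -w * y) * Complex.exp (p + q * z + w * y) = 1 := by
  rw [← Complex.exp_add, show -p + -q * z + -w * y + (p + q * z + w * y) = 0 by ring, Complex.exp_zero]

/-- `(n(e^{θ₀+θs+φr} − 1))* = n(e^{−θ₀−θs−φr} − 1)` for `θ₀ = I·a₀∕n`, `θ = I·a∕n`, `φ = I·b∕n`, real data. [folklore] -/
theorem star_conn_expChartAt₂ (a₀ a b : ℝ) (n : ℕ) (s r : ℝ) :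
    star (((n : ℕ) : ℂ) * (Complex.exp (Complex.I * (a₀ : ℂ) / ((n : ℕ) : ℂ) + (Complex.I * (a : ℂ) / ((n : ℕ) : ℂ)) * (s : ℂ) + (Complex.I * (b : ℂ) / ((n : ℕ) : ℂ)) * (r : ℂ)) - 1))
      = ((n : ℕ) : ℂ) * (Complex.exp (-(Complex.I * (a₀ : ℂ) / ((n : ℕ) : ℂ)) + -(Complex.I * (a : ℂ) / ((n : ℕ) : ℂ)) * (s : ℂ) + -(Complex.I * (b : ℂ) / ((n : ℕ) : ℂ)) * (r : ℂ))
          - 1) := by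
  rw [Complex.star_def, map_mul, map_natCast, map_sub, map_one, ← Complex.exp_conj]
  simp only [map_add, map_mul, conj_theta, Complex.conj_ofReal]

end Scalar

/-! ## §2 The chart at the base point: swap, origin, connection and zeroth-order field -/

section Chart

variable {d : ℕ} (L : ℕ) [NeZero L] (M : Fin d → ℕ) [hM : ∀ μ, NeZero (M μ)]

omit [NeZero L] hM in
/-- the swap `(A, B, s, r) ↔ (B, A, r, s)` at the base point. [folklore] -/
theorem expChartAt₂_swap (A₀ A B : (k : ℕ) → Fin d → (idx L M k → ℝ)) (s r : ℝ) :
    (fun k ν (x : idx L M k) => Complex.exp (Complex.I * (A₀ k ν x : ℂ) / ((lev L k : ℕ) : ℂ) + (Complex.I * (A k ν x : ℂ) / ((lev L k : ℕ) : ℂ)) * (s : ℂ) + (Complex.I * (B k ν x : ℂ) / ((lev L k : ℕ) : ℂ)) * (r : ℂ)))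
      = fun k ν x => Complex.exp (Complex.I * (A₀ k ν x : ℂ) / ((lev L k : ℕ) : ℂ) + (Complex.I * (B k ν x : ℂ) / ((lev L k : ℕ) : ℂ)) * (r : ℂ) + (Complex.I * (A k ν x : ℂ) / ((lev L k : ℕ) : ℂ)) * (s : ℂ)) := by
  funext k ν x
  rw [add_right_comm]

omit [NeZero L] hM in
/-- at the origin the chart is the BASE transporter `U₀ = e^{θ₀}`. [folklore] -/
theorem expChartAt₂_zero_zero (A₀ A B : (k : ℕ) → Fin d → (idx L M k → ℝ)) :
    (fun k ν (x : idx L M k) => Complex.exp (Complex.I * (A₀ k ν x : ℂ) / ((lev L k : ℕ) : ℂ) + (Complex.I * (A k ν x : ℂ) / ((lev L k : ℕ) : ℂ)) * ((0 : ℝ) : ℂ) + (Complex.I * (B k ν x : ℂ) / ((lev L k : ℕ) : ℂ)) * ((0 : ℝ) : ℂ))) = fun k ν x => Complex.exp (Complex.I * (A₀ k ν x : ℂ) / ((lev L k : ℕ) : ℂ)) := by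
  funext k ν x
  rw [Complex.ofReal_zero, mul_zero, mul_zero, add_zero, add_zero]

omit [NeZero L] hM in
/-- **`connV_expChartAt₂`**: `−w_{s,r} = n − n·e^{θ₀ + θs + φr}` at every level. [folklore] -/
theorem connV_expChartAt₂ (A₀ A B : (k : ℕ) → Fin d → (idx L M k → ℝ)) (s r : ℝ) :
    connV L M (fun k ν x => Complex.exp (Complex.I * (A₀ k ν x : ℂ) / ((lev L k : ℕ) : ℂ) + (Complex.I * (A k ν x : ℂ) / ((lev L k : ℕ) : ℂ)) * (s : ℂ) + (Complex.I * (B k ν x : ℂ) / ((lev L k : ℕ) : ℂ)) * (r : ℂ)))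
      = fun k ν x => ((lev L k : ℕ) : ℂ) - ((lev L k : ℕ) : ℂ) * Complex.exp (Complex.I * (A₀ k ν x : ℂ) / ((lev L k : ℕ) : ℂ) + (Complex.I * (A k ν x : ℂ) / ((lev L k : ℕ) : ℂ)) * (s : ℂ) + (Complex.I * (B k ν x : ℂ) / ((lev L k : ℕ) : ℂ)) * (r : ℂ)) := by
  funext k ν x
  simp only [connV, negConn, conn]
  ring

omit [NeZero L] hM in
/-- **`zT_expChartAt₂`**: for REAL data the zeroth-order field of the chart at the base point is UNSHIFTED: `z_{s,r}(x) = −n²·Σ_ν (e^{θ₀+θs+φr} + e^{−θ₀−θs−φr} − 2)`.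
[folklore] -/
theorem zT_expChartAt₂ (A₀ A B : (k : ℕ) → Fin d → (idx L M k → ℝ)) (s r : ℝ) :
    zT L M (fun k ν x => Complex.exp (Complex.I * (A₀ k ν x : ℂ) / ((lev L k : ℕ) : ℂ) + (Complex.I * (A k ν x : ℂ) / ((lev L k : ℕ) : ℂ)) * (s : ℂ) + (Complex.I * (B k ν x : ℂ) / ((lev L k : ℕ) : ℂ)) * (r : ℂ)))
      = fun k x => -((lev L k : ℕ) : ℂ) ^ 2 * ∑ ν, (Complex.exp (Complex.I * (A₀ k ν x : ℂ) / ((lev L k : ℕ) : ℂ) + (Complex.I * (A k ν x : ℂ) / ((lev L k : ℕ) : ℂ)) * (s : ℂ) + (Complex.I * (B k ν x : ℂ) / ((lev L k : ℕ) : ℂ)) * (r : ℂ))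
          + Complex.exp (-(Complex.I * (A₀ k ν x : ℂ) / ((lev L k : ℕ) : ℂ)) + -(Complex.I * (A k ν x : ℂ) / ((lev L k : ℕ) : ℂ)) * (s : ℂ) + -(Complex.I * (B k ν x : ℂ) / ((lev L k : ℕ) : ℂ)) * (r : ℂ)) - 2) := by
  funext k x
  simp only [zT, zfield, conn]
  rw [Finset.mul_sum]
  refine Finset.sum_congr rfl fun ν _ => ?_
  rw [star_conn_expChartAt₂, star_conn_expChartAt₂]
  linear_combination (((lev L k : ℕ) : ℂ) ^ 2)
    * cexp_neg_add₃_mul_cexp (Complex.I * (A₀ k ν (tauInv (fine (lev L k) M) ν x) : ℂ) / ((lev L k : ℕ) : ℂ)) (Complex.I * (A k ν (tauInv (fine (lev L k) M) ν x) : ℂ) / ((lev L k : ℕ) : ℂ))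
        (Complex.I * (B k ν (tauInv (fine (lev L k) M) ν x) : ℂ) / ((lev L k : ℕ) : ℂ)) (s : ℂ) (r : ℂ)

/-- at the origin the perturbation is the BASE LETTER `Δ^{U₀} − Δ^1`. [folklore] -/
theorem covPert_expChartAt₂_zero_zero (A₀ A B : (k : ℕ) → Fin d → (idx L M k → ℝ)) (k : ℕ) :
    covPert L M (fun k ν (x : idx L M k) => Complex.exp (Complex.I * (A₀ k ν x : ℂ) / ((lev L k : ℕ) : ℂ) + (Complex.I * (A k ν x : ℂ) / ((lev L k : ℕ) : ℂ)) * ((0 : ℝ) : ℂ) + (Complex.I * (B k ν x : ℂ) / ((lev L k : ℕ) : ℂ)) * ((0 : ℝ) : ℂ))) k = covPert L M (fun k ν (x : idx L M k) => Complex.exp (Complex.I * (A₀ k ν x : ℂ) / ((lev L k : ℕ) : ℂ))) k := by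
  rw [expChartAt₂_zero_zero]

end Chart

/-! ## §3 The separate partial jets at the origin (scalar): PART 252's jets twisted by the base phase -/

section Jets

variable {d : ℕ} (L : ℕ) [NeZero L] (M : Fin d → ℕ) [hM : ∀ μ, NeZero (M μ)]

omit hM in
/-- **`hasDerivAt_connV_expChartAt₂_fst`**: for every `r`, `∂_s|₀(−w_{s,r})^{(k)}_ν(x) = −iA^{(k)}_ν(x)·e^{θ₀ + φr}`. [folklore] -/
theorem hasDerivAt_connV_expChartAt₂_fst (A₀ A B : (k : ℕ) → Fin d → (idx L M k → ℝ)) (r : ℝ) (k : ℕ) (ν : Fin d) (x : idx L M k) :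
    HasDerivAt (fun s : ℝ => connV L M (fun k' ν' (x' : idx L M k') => Complex.exp (Complex.I * (A₀ k' ν' x' : ℂ) / ((lev L k' : ℕ) : ℂ) + (Complex.I * (A k' ν' x' : ℂ) / ((lev L k' : ℕ) : ℂ)) * (s : ℂ) + (Complex.I * (B k' ν' x' : ℂ) / ((lev L k' : ℕ) : ℂ)) * (r : ℂ))) k ν x)
      (-(Complex.I * (A k ν x : ℂ)) * Complex.exp (Complex.I * (A₀ k ν x : ℂ) / ((lev L k : ℕ) : ℂ) + (Complex.I * (B k ν x : ℂ) / ((lev L k : ℕ) : ℂ)) * (r : ℂ))) 0 := by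
  simp only [connV_expChartAt₂]
  have h := (hasDerivAt_const_mul_cexp_add₃_fst ((lev L k : ℕ) : ℂ) (Complex.I * (A₀ k ν x : ℂ) / ((lev L k : ℕ) : ℂ)) (Complex.I * (A k ν x : ℂ) / ((lev L k : ℕ) : ℂ)) (Complex.I * (B k ν x : ℂ) / ((lev L k : ℕ) : ℂ)) r 0).const_sub (((lev L k : ℕ) : ℂ))
  refine h.congr_deriv ?_
  have hn : ((lev L k : ℕ) : ℂ) ≠ 0 := by exact_mod_cast NeZero.ne (lev L k)
  rw [Complex.ofReal_zero, mul_zero, add_zero]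
  field_simp

omit [NeZero L] hM in
/-- **`hasDerivAt_mixedJetV_base`** — THE MIXED CONNECTION JET AT THE BASE POINT: `∂_r|₀[−iA·e^{θ₀ + φr}] = −(iA)(iB∕n)e^{θ₀}`. [folklore] -/
theorem hasDerivAt_mixedJetV_base (A₀ A B : (k : ℕ) → Fin d → (idx L M k → ℝ)) (k : ℕ) (ν : Fin d) (x : idx L M k) :
    HasDerivAt (fun r : ℝ => -(Complex.I * (A k ν x : ℂ)) * Complex.exp (Complex.I * (A₀ k ν x : ℂ) / ((lev L k : ℕ) : ℂ) + (Complex.I * (B k ν x : ℂ) / ((lev L k : ℕ) : ℂ)) * (r : ℂ)))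
      (-(Complex.I * (A k ν x : ℂ)) * (Complex.I * (B k ν x : ℂ) / ((lev L k : ℕ) : ℂ)) * Complex.exp (Complex.I * (A₀ k ν x : ℂ) / ((lev L k : ℕ) : ℂ))) 0 := by
  have h := hasDerivAt_const_mul_cexp_base (-(Complex.I * (A k ν x : ℂ))) (Complex.I * (A₀ k ν x : ℂ) / ((lev L k : ℕ) : ℂ)) (Complex.I * (B k ν x : ℂ) / ((lev L k : ℕ) : ℂ)) 0
  refine h.congr_deriv ?_
  rw [Complex.ofReal_zero, mul_zero, add_zero]

omit [NeZero L] hM in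
/-- **`hasDerivAt_zT_expChartAt₂_fst`**: for every `r`, `∂_s|₀z^{(k)}_{s,r}(x) = −n_k²Σ_ν(θ_νe^{θ₀,ν + φ_νr} + (−θ_ν)e^{−θ₀,ν − φ_νr})`. [folklore] -/
theorem hasDerivAt_zT_expChartAt₂_fst (A₀ A B : (k : ℕ) → Fin d → (idx L M k → ℝ)) (r : ℝ) (k : ℕ) (x : idx L M k) :
    HasDerivAt (fun s : ℝ => zT L M (fun k' ν' (x' : idx L M k') => Complex.exp (Complex.I * (A₀ k' ν' x' : ℂ) / ((lev L k' : ℕ) : ℂ) + (Complex.I * (A k' ν' x' : ℂ) / ((lev L k' : ℕ) : ℂ)) * (s : ℂ) + (Complex.I * (B k' ν' x' : ℂ) / ((lev L k' : ℕ) : ℂ)) * (r : ℂ))) k x)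
      (-((lev L k : ℕ) : ℂ) ^ 2 * ∑ ν, ((Complex.I * (A k ν x : ℂ) / ((lev L k : ℕ) : ℂ)) * Complex.exp (Complex.I * (A₀ k ν x : ℂ) / ((lev L k : ℕ) : ℂ) + (Complex.I * (B k ν x : ℂ) / ((lev L k : ℕ) : ℂ)) * (r : ℂ))
          + -(Complex.I * (A k ν x : ℂ) / ((lev L k : ℕ) : ℂ)) * Complex.exp (-(Complex.I * (A₀ k ν x : ℂ) / ((lev L k : ℕ) : ℂ)) + -(Complex.I * (B k ν x : ℂ) / ((lev L k : ℕ) : ℂ)) * (r : ℂ)))) 0 := by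
  simp only [zT_expChartAt₂]
  have h : HasDerivAt (fun s : ℝ => -((lev L k : ℕ) : ℂ) ^ 2 * ∑ ν, (Complex.exp (Complex.I * (A₀ k ν x : ℂ) / ((lev L k : ℕ) : ℂ) + (Complex.I * (A k ν x : ℂ) / ((lev L k : ℕ) : ℂ)) * (s : ℂ) + (Complex.I * (B k ν x : ℂ) / ((lev L k : ℕ) : ℂ)) * (r : ℂ))
          + Complex.exp (-(Complex.I * (A₀ k ν x : ℂ) / ((lev L k : ℕ) : ℂ)) + -(Complex.I * (A k ν x : ℂ) / ((lev L k : ℕ) : ℂ)) * (s : ℂ) + -(Complex.I * (B k ν x : ℂ) / ((lev L k : ℕ) : ℂ)) * (r : ℂ)) - 2))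
      (-((lev L k : ℕ) : ℂ) ^ 2 * ∑ ν, ((Complex.I * (A k ν x : ℂ) / ((lev L k : ℕ) : ℂ)) * Complex.exp (Complex.I * (A₀ k ν x : ℂ) / ((lev L k : ℕ) : ℂ) + (Complex.I * (A k ν x : ℂ) / ((lev L k : ℕ) : ℂ)) * ((0 : ℝ) : ℂ) + (Complex.I * (B k ν x : ℂ) / ((lev L k : ℕ) : ℂ)) * (r : ℂ))
          + -(Complex.I * (A k ν x : ℂ) / ((lev L k : ℕ) : ℂ)) * Complex.exp (-(Complex.I * (A₀ k ν x : ℂ) / ((lev L k : ℕ) : ℂ)) + -(Complex.I * (A k ν x : ℂ) / ((lev L k : ℕ) : ℂ)) * ((0 : ℝ) : ℂ) + -(Complex.I * (B k ν x : ℂ) / ((lev L k : ℕ) : ℂ)) * (r : ℂ)))) 0 :=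
    (HasDerivAt.fun_sum fun ν _ => ((hasDerivAt_cexp_add₃_fst _ _ _ r 0).fun_add (hasDerivAt_cexp_add₃_fst _ _ _ r 0)).sub_const (2 : ℂ)).const_mul _
  refine h.congr_deriv ?_
  simp only [Complex.ofReal_zero, mul_zero, add_zero]

omit hM in
/-- **`hasDerivAt_mixedJetZ_base`** — THE MIXED ZEROTH-ORDER JET AT THE BASE POINT: `∂_r|₀[−n²Σ_ν(θ_νe^{θ₀,ν+φ_νr} + (−θ_ν)e^{−θ₀,ν−φ_νr})] = −Σ_ν(iA_ν)(iB_ν)(e^{θ₀,ν} + e^{−θ₀,ν})`.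
[folklore] -/
theorem hasDerivAt_mixedJetZ_base (A₀ A B : (k : ℕ) → Fin d → (idx L M k → ℝ)) (k : ℕ) (x : idx L M k) :
    HasDerivAt (fun r : ℝ => -((lev L k : ℕ) : ℂ) ^ 2 * ∑ ν, ((Complex.I * (A k ν x : ℂ) / ((lev L k : ℕ) : ℂ)) * Complex.exp (Complex.I * (A₀ k ν x : ℂ) / ((lev L k : ℕ) : ℂ) + (Complex.I * (B k ν x : ℂ) / ((lev L k : ℕ) : ℂ)) * (r : ℂ))
          + -(Complex.I * (A k ν x : ℂ) / ((lev L k : ℕ) : ℂ)) * Complex.exp (-(Complex.I * (A₀ k ν x : ℂ) / ((lev L k : ℕ) : ℂ)) + -(Complex.I * (B k ν x : ℂ) / ((lev L k : ℕ) : ℂ)) * (r : ℂ))))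
      (-∑ ν, (Complex.I * (A k ν x : ℂ)) * (Complex.I * (B k ν x : ℂ)) * (Complex.exp (Complex.I * (A₀ k ν x : ℂ) / ((lev L k : ℕ) : ℂ)) + Complex.exp (-(Complex.I * (A₀ k ν x : ℂ) / ((lev L k : ℕ) : ℂ))))) 0 := by
  have h : HasDerivAt (fun r : ℝ => -((lev L k : ℕ) : ℂ) ^ 2 * ∑ ν, ((Complex.I * (A k ν x : ℂ) / ((lev L k : ℕ) : ℂ)) * Complex.exp (Complex.I * (A₀ k ν x : ℂ) / ((lev L k : ℕ) : ℂ) + (Complex.I * (B k ν x : ℂ) / ((lev L k : ℕ) : ℂ)) * (r : ℂ))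
          + -(Complex.I * (A k ν x : ℂ) / ((lev L k : ℕ) : ℂ)) * Complex.exp (-(Complex.I * (A₀ k ν x : ℂ) / ((lev L k : ℕ) : ℂ)) + -(Complex.I * (B k ν x : ℂ) / ((lev L k : ℕ) : ℂ)) * (r : ℂ))))
      (-((lev L k : ℕ) : ℂ) ^ 2 * ∑ ν, ((Complex.I * (A k ν x : ℂ) / ((lev L k : ℕ) : ℂ)) * (Complex.I * (B k ν x : ℂ) / ((lev L k : ℕ) : ℂ)) * Complex.exp (Complex.I * (A₀ k ν x : ℂ) / ((lev L k : ℕ) : ℂ) + (Complex.I * (B k ν x : ℂ) / ((lev L k : ℕ) : ℂ)) * ((0 : ℝ) : ℂ))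
          + -(Complex.I * (A k ν x : ℂ) / ((lev L k : ℕ) : ℂ)) * (-(Complex.I * (B k ν x : ℂ) / ((lev L k : ℕ) : ℂ))) * Complex.exp (-(Complex.I * (A₀ k ν x : ℂ) / ((lev L k : ℕ) : ℂ)) + -(Complex.I * (B k ν x : ℂ) / ((lev L k : ℕ) : ℂ)) * ((0 : ℝ) : ℂ)))) 0 :=
    (HasDerivAt.fun_sum fun ν _ => (hasDerivAt_const_mul_cexp_base _ _ _ 0).fun_add (hasDerivAt_const_mul_cexp_base _ _ _ 0)).const_mul _
  refine h.congr_deriv ?_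
  have hn : ((lev L k : ℕ) : ℂ) ≠ 0 := by exact_mod_cast NeZero.ne (lev L k)
  simp only [Complex.ofReal_zero, mul_zero, add_zero]
  rw [Finset.mul_sum, ← Finset.sum_neg_distrib]
  refine Finset.sum_congr rfl fun ν _ => ?_
  field_simp

omit [NeZero L] hM in
/-- at `r = 0` the first connection partial jet is the twisted first jet `−iA·e^{θ₀}`. [folklore] -/
theorem mixedCurveV_base_zero (A₀ A B : (k : ℕ) → Fin d → (idx L M k → ℝ)) :
    (fun k' ν' (x' : idx L M k') => -(Complex.I * (A k' ν' x' : ℂ)) * Complex.exp (Complex.I * (A₀ k' ν' x' : ℂ) / ((lev L k' : ℕ) : ℂ) + (Complex.I * (B k' ν' x' : ℂ) / ((lev L k' : ℕ) : ℂ)) * ((0 : ℝ) : ℂ)))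
      = (fun k' ν' (x' : idx L M k') => -(Complex.I * (A k' ν' x' : ℂ)) * Complex.exp (Complex.I * (A₀ k' ν' x' : ℂ) / ((lev L k' : ℕ) : ℂ))) := by
  funext k ν x
  rw [Complex.ofReal_zero, mul_zero, add_zero]

omit hM in
/-- at `r = 0` the first zeroth-order partial jet is `−nΣ_ν(iA_ν)(e^{θ₀,ν} − e^{−θ₀,ν})` (it vanishes only at `A₀ = 0`). [folklore] -/
theorem mixedCurveZ_base_zero (A₀ A B : (k : ℕ) → Fin d → (idx L M k → ℝ)) (k : ℕ) :
    (fun x' : idx L M k => -((lev L k : ℕ) : ℂ) ^ 2 * ∑ ν, ((Complex.I * (A k ν x' : ℂ) / ((lev L k : ℕ) : ℂ)) * Complex.exp (Complex.I * (A₀ k ν x' : ℂ) / ((lev L k : ℕ) : ℂ) + (Complex.I * (B k ν x' : ℂ) / ((lev L k : ℕ) : ℂ)) * ((0 : ℝ) : ℂ))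
          + -(Complex.I * (A k ν x' : ℂ) / ((lev L k : ℕ) : ℂ)) * Complex.exp (-(Complex.I * (A₀ k ν x' : ℂ) / ((lev L k : ℕ) : ℂ)) + -(Complex.I * (B k ν x' : ℂ) / ((lev L k : ℕ) : ℂ)) * ((0 : ℝ) : ℂ))))
      = (fun x' : idx L M k => -((lev L k : ℕ) : ℂ) * ∑ ν, (Complex.I * (A k ν x' : ℂ)) * (Complex.exp (Complex.I * (A₀ k ν x' : ℂ) / ((lev L k : ℕ) : ℂ)) - Complex.exp (-(Complex.I * (A₀ k ν x' : ℂ) / ((lev L k : ℕ) : ℂ))))) := by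
  funext x
  have hn : ((lev L k : ℕ) : ℂ) ≠ 0 := by exact_mod_cast NeZero.ne (lev L k)
  simp only [Complex.ofReal_zero, mul_zero, add_zero]
  rw [Finset.mul_sum, Finset.mul_sum]
  refine Finset.sum_congr rfl fun ν _ => ?_
  field_simp
  ring

end Jets

/-! ## §4 Matrix level: the separate partial derivatives of `Δ^{U_{s,r}} − Δ^1` at the origin of the chart at the base point -/

section Letters

variable {d : ℕ} (L : ℕ) [NeZero L] (M : Fin d → ℕ) [hM : ∀ μ, NeZero (M μ)]

/-- **`hasDerivAt_covPert_expChartAt₂_fst` — `∂_s|₀(Δ^{U_{s,r}} − Δ^1)^{(k)} = P(V₁₀(r)) + P(V₁₀(r))ᴴ + diag Z₁₀(r)` FOR EVERY `r`** with `V₁₀(r) = −iA·e^{θ₀ + φr}`,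
`Z₁₀(r) = −n²Σ_ν(θ_νe^{θ₀,ν+φ_νr} + (−θ_ν)e^{−θ₀,ν−φ_νr})`: the hypothesis `h10` of PART 251 at the base point. [folklore] -/
theorem hasDerivAt_covPert_expChartAt₂_fst (A₀ A B : (k : ℕ) → Fin d → (idx L M k → ℝ)) (r : ℝ) (k : ℕ) :
    HasDerivAt (fun s : ℝ => covPert L M (fun k' ν' (x' : idx L M k') => Complex.exp (Complex.I * (A₀ k' ν' x' : ℂ) / ((lev L k' : ℕ) : ℂ) + (Complex.I * (A k' ν' x' : ℂ) / ((lev L k' : ℕ) : ℂ)) * (s : ℂ) + (Complex.I * (B k' ν' x' : ℂ) / ((lev L k' : ℕ) : ℂ)) * (r : ℂ))) k)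
      (Pmodel L M (fun k' ν' (x' : idx L M k') => -(Complex.I * (A k' ν' x' : ℂ)) * Complex.exp (Complex.I * (A₀ k' ν' x' : ℂ) / ((lev L k' : ℕ) : ℂ) + (Complex.I * (B k' ν' x' : ℂ) / ((lev L k' : ℕ) : ℂ)) * (r : ℂ))) k + (Pmodel L M (fun k' ν' (x' : idx L M k') => -(Complex.I * (A k' ν' x' : ℂ)) * Complex.exp (Complex.I * (A₀ k' ν' x' : ℂ) / ((lev L k' : ℕ) : ℂ) + (Complex.I * (B k' ν' x' : ℂ) / ((lev L k' : ℕ) : ℂ)) * (r : ℂ))) k)ᴴ + Matrix.diagonal (fun x' : idx L M k => -((lev L k : ℕ) : ℂ) ^ 2 * ∑ ν, ((Complex.I * (A k ν x' : ℂ) / ((lev L k : ℕ) : ℂ)) * Complex.exp (Complex.I * (A₀ k ν x' : ℂ) / ((lev L k : ℕ) : ℂ) + (Complex.I * (B k ν x' : ℂ) / ((lev L k : ℕ) : ℂ)) * (r : ℂ))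
          + -(Complex.I * (A k ν x' : ℂ) / ((lev L k : ℕ) : ℂ)) * Complex.exp (-(Complex.I * (A₀ k ν x' : ℂ) / ((lev L k : ℕ) : ℂ)) + -(Complex.I * (B k ν x' : ℂ) / ((lev L k : ℕ) : ℂ)) * (r : ℂ))))) 0 := by
  have e : (fun s : ℝ => covPert L M (fun k' ν' (x' : idx L M k') => Complex.exp (Complex.I * (A₀ k' ν' x' : ℂ) / ((lev L k' : ℕ) : ℂ) + (Complex.I * (A k' ν' x' : ℂ) / ((lev L k' : ℕ) : ℂ)) * (s : ℂ) + (Complex.I * (B k' ν' x' : ℂ) / ((lev L k' : ℕ) : ℂ)) * (r : ℂ))) k)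
      = fun s : ℝ => Pmodel L M (connV L M (fun k' ν' (x' : idx L M k') => Complex.exp (Complex.I * (A₀ k' ν' x' : ℂ) / ((lev L k' : ℕ) : ℂ) + (Complex.I * (A k' ν' x' : ℂ) / ((lev L k' : ℕ) : ℂ)) * (s : ℂ) + (Complex.I * (B k' ν' x' : ℂ) / ((lev L k' : ℕ) : ℂ)) * (r : ℂ)))) k
        + (Pmodel L M (connV L M (fun k' ν' (x' : idx L M k') => Complex.exp (Complex.I * (A₀ k' ν' x' : ℂ) / ((lev L k' : ℕ) : ℂ) + (Complex.I * (A k' ν' x' : ℂ) / ((lev L k' : ℕ) : ℂ)) * (s : ℂ) + (Complex.I * (B k' ν' x' : ℂ) / ((lev L k' : ℕ) : ℂ)) * (r : ℂ)))) k)ᴴ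
        + Matrix.diagonal (zT L M (fun k' ν' (x' : idx L M k') => Complex.exp (Complex.I * (A₀ k' ν' x' : ℂ) / ((lev L k' : ℕ) : ℂ) + (Complex.I * (A k' ν' x' : ℂ) / ((lev L k' : ℕ) : ℂ)) * (s : ℂ) + (Complex.I * (B k' ν' x' : ℂ) / ((lev L k' : ℕ) : ℂ)) * (r : ℂ))) k) :=
    funext fun s => covPert_eq L M _ k
  rw [e]
  exact ((hasDerivAt_Pmodel_curve L M k (fun μ y => hasDerivAt_connV_expChartAt₂_fst L M A₀ A B r k μ y)).add
    (hasDerivAt_conjTranspose_Pmodel_curve L M k (fun μ y => hasDerivAt_connV_expChartAt₂_fst L M A₀ A B r k μ y))).add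
    (hasDerivAt_diagonal_curve L M k
      (Z := fun (s : ℝ) (k' : ℕ) => zT L M (fun k' ν' (x' : idx L M k') => Complex.exp (Complex.I * (A₀ k' ν' x' : ℂ) / ((lev L k' : ℕ) : ℂ) + (Complex.I * (A k' ν' x' : ℂ) / ((lev L k' : ℕ) : ℂ)) * (s : ℂ) + (Complex.I * (B k' ν' x' : ℂ) / ((lev L k' : ℕ) : ℂ)) * (r : ℂ))) k')
      (Z' := fun (k' : ℕ) => (fun x' : idx L M k' => -((lev L k' : ℕ) : ℂ) ^ 2 * ∑ ν, ((Complex.I * (A k' ν x' : ℂ) / ((lev L k' : ℕ) : ℂ)) * Complex.exp (Complex.I * (A₀ k' ν x' : ℂ) / ((lev L k' : ℕ) : ℂ) + (Complex.I * (B k' ν x' : ℂ) / ((lev L k' : ℕ) : ℂ)) * (r : ℂ))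
          + -(Complex.I * (A k' ν x' : ℂ) / ((lev L k' : ℕ) : ℂ)) * Complex.exp (-(Complex.I * (A₀ k' ν x' : ℂ) / ((lev L k' : ℕ) : ℂ)) + -(Complex.I * (B k' ν x' : ℂ) / ((lev L k' : ℕ) : ℂ)) * (r : ℂ)))))
      (fun y => hasDerivAt_zT_expChartAt₂_fst L M A₀ A B r k y))

/-- **`hasDerivAt_mixedLetter_base` — THE MIXED COUPLING LETTER AT THE BASE POINT**: `∂_r|₀[P(V₁₀(r)) + P(V₁₀(r))ᴴ + diag Z₁₀(r)] = P(V₁₁) + P(V₁₁)ᴴ + diag Z₁₁` with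
`V₁₁ = −(iA)(iB∕n)e^{θ₀}`, `Z₁₁ = −Σ_ν(iA_ν)(iB_ν)(e^{θ₀,ν} + e^{−θ₀,ν})`: the hypothesis `h11` of PART 251 at the base point. [folklore] -/
theorem hasDerivAt_mixedLetter_base (A₀ A B : (k : ℕ) → Fin d → (idx L M k → ℝ)) (k : ℕ) :
    HasDerivAt (fun r : ℝ => Pmodel L M (fun k' ν' (x' : idx L M k') => -(Complex.I * (A k' ν' x' : ℂ)) * Complex.exp (Complex.I * (A₀ k' ν' x' : ℂ) / ((lev L k' : ℕ) : ℂ) + (Complex.I * (B k' ν' x' : ℂ) / ((lev L k' : ℕ) : ℂ)) * (r : ℂ))) k + (Pmodel L M (fun k' ν' (x' : idx L M k') => -(Complex.I * (A k' ν' x' : ℂ)) * Complex.exp (Complex.I * (A₀ k' ν' x' : ℂ) / ((lev L k' : ℕ) : ℂ) + (Complex.I * (B k' ν' x' : ℂ) / ((lev L k' : ℕ) : ℂ)) * (r : ℂ))) k)ᴴ + Matrix.diagonal (fun x' : idx L M k => -((lev L k : ℕ) : ℂ) ^ 2 * ∑ ν, ((Complex.I * (A k ν x' : ℂ) / ((lev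 L k : ℕ) : ℂ)) * Complex.exp (Complex.I * (A₀ k ν x' : ℂ) / ((lev L k : ℕ) : ℂ) + (Complex.I * (B k ν x' : ℂ) / ((lev L k : ℕ) : ℂ)) * (r : ℂ))
          + -(Complex.I * (A k ν x' : ℂ) / ((lev L k : ℕ) : ℂ)) * Complex.exp (-(Complex.I * (A₀ k ν x' : ℂ) / ((lev L k : ℕ) : ℂ)) + -(Complex.I * (B k ν x' : ℂ) / ((lev L k : ℕ) : ℂ)) * (r : ℂ)))))
      (Pmodel L M (fun k' ν' (x' : idx L M k') => -(Complex.I * (A k' ν' x' : ℂ)) * (Complex.I * (B k' ν' x' : ℂ) / ((lev L k' : ℕ) : ℂ)) * Complex.exp (Complex.I * (A₀ k' ν' x' : ℂ) / ((lev L k' : ℕ) : ℂ))) k + (Pmodel L M (fun k' ν' (x' : idx L M k') => -(Complex.I * (A k' ν' x' : ℂ)) * (Complex.I * (B k' ν' x' : ℂ) / ((lev L k' : ℕ) : ℂ)) * Complex.exp (Complex.I * (A₀ k' ν' x' : ℂ) / ((lev L k' : ℕ) : ℂ))) k)ᴴ + Matrix.diagonal (fun x' : idx L M k => -∑ ν,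 (Complex.I * (A k ν x' : ℂ)) * (Complex.I * (B k ν x' : ℂ)) * (Complex.exp (Complex.I * (A₀ k ν x' : ℂ) / ((lev L k : ℕ) : ℂ)) + Complex.exp (-(Complex.I * (A₀ k ν x' : ℂ) / ((lev L k : ℕ) : ℂ)))))) 0 :=
  ((hasDerivAt_Pmodel_curve L M k (fun μ y => hasDerivAt_mixedJetV_base L M A₀ A B k μ y)).add
    (hasDerivAt_conjTranspose_Pmodel_curve L M k (fun μ y => hasDerivAt_mixedJetV_base L M A₀ A B k μ y))).add
    (hasDerivAt_diagonal_curve L M k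
      (Z := fun (r : ℝ) (k' : ℕ) => (fun x' : idx L M k' => -((lev L k' : ℕ) : ℂ) ^ 2 * ∑ ν, ((Complex.I * (A k' ν x' : ℂ) / ((lev L k' : ℕ) : ℂ)) * Complex.exp (Complex.I * (A₀ k' ν x' : ℂ) / ((lev L k' : ℕ) : ℂ) + (Complex.I * (B k' ν x' : ℂ) / ((lev L k' : ℕ) : ℂ)) * (r : ℂ))
          + -(Complex.I * (A k' ν x' : ℂ) / ((lev L k' : ℕ) : ℂ)) * Complex.exp (-(Complex.I * (A₀ k' ν x' : ℂ) / ((lev L k' : ℕ) : ℂ)) + -(Complex.I * (B k' ν x' : ℂ) / ((lev L k' : ℕ) : ℂ)) * (r : ℂ)))))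
      (Z' := fun (k' : ℕ) => (fun x' : idx L M k' => -∑ ν, (Complex.I * (A k' ν x' : ℂ)) * (Complex.I * (B k' ν x' : ℂ)) * (Complex.exp (Complex.I * (A₀ k' ν x' : ℂ) / ((lev L k' : ℕ) : ℂ)) + Complex.exp (-(Complex.I * (A₀ k' ν x' : ℂ) / ((lev L k' : ℕ) : ℂ))))))
      (fun y => hasDerivAt_mixedJetZ_base L M A₀ A B k y))

/-- **`mixedLetter_base_fst_zero`**: at `r = 0` the first partial letter is the twisted first letter of `A` WITH its zeroth-order part,
`P(−iA·e^{θ₀}) + P(−iA·e^{θ₀})ᴴ + diag(−nΣ_ν(iA_ν)(e^{θ₀,ν} − e^{−θ₀,ν}))`: the hypothesis `ha` of PART 251 at the base point. [folklore] -/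
theorem mixedLetter_base_fst_zero (A₀ A B : (k : ℕ) → Fin d → (idx L M k → ℝ)) (k : ℕ) :
    Pmodel L M (fun k' ν' (x' : idx L M k') => -(Complex.I * (A k' ν' x' : ℂ)) * Complex.exp (Complex.I * (A₀ k' ν' x' : ℂ) / ((lev L k' : ℕ) : ℂ) + (Complex.I * (B k' ν' x' : ℂ) / ((lev L k' : ℕ) : ℂ)) * ((0 : ℝ) : ℂ))) k + (Pmodel L M (fun k' ν' (x' : idx L M k') => -(Complex.I * (A k' ν' x' : ℂ)) * Complex.exp (Complex.I * (A₀ k' ν' x' : ℂ) / ((lev L k' : ℕ) : ℂ) + (Complex.I * (B k' ν' x' : ℂ) / ((lev L k' : ℕ) : ℂ)) * ((0 : ℝ) : ℂ))) k)ᴴ + Matrix.diagonal (fun x' : idx L M k => -((lev L k : ℕ) : ℂ) ^ 2 * ∑ ν, ((Complex.I * (A k ν x' : ℂ) / ((lev L k : ℕ) : ℂ)) * Complex.exp (Complex.I * (A₀ k ν x' : ℂ) / ((lev L k : ℕ) : ℂ) + (Complex.I * (B k ν x' : ℂ) / ((lev L k : ℕ) : ℂ)) * ((0 : ℝ) : 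ℂ))
          + -(Complex.I * (A k ν x' : ℂ) / ((lev L k : ℕ) : ℂ)) * Complex.exp (-(Complex.I * (A₀ k ν x' : ℂ) / ((lev L k : ℕ) : ℂ)) + -(Complex.I * (B k ν x' : ℂ) / ((lev L k : ℕ) : ℂ)) * ((0 : ℝ) : ℂ))))
      = Pmodel L M (fun k' ν' (x' : idx L M k') => -(Complex.I * (A k' ν' x' : ℂ)) * Complex.exp (Complex.I * (A₀ k' ν' x' : ℂ) / ((lev L k' : ℕ) : ℂ))) k + (Pmodel L M (fun k' ν' (x' : idx L M k') => -(Complex.I * (A k' ν' x' : ℂ)) * Complex.exp (Complex.I * (A₀ k' ν' x' : ℂ) / ((lev L k' : ℕ) : ℂ))) k)ᴴ + Matrix.diagonal (fun x' : idx L M k => -((lev L k : ℕ) : ℂ) * ∑ ν, (Complex.I * (A k ν x' : ℂ)) * (Complex.exp (Complex.I * (A₀ k ν x' : ℂ) / ((lev L k : ℕ) : ℂ)) - Complex.exp (-(Complex.I * (A₀ k ν x' : ℂ) / ((lev L k : ℕ) : ℂ))))) := by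
  rw [mixedCurveV_base_zero L M A₀ A B, mixedCurveZ_base_zero L M A₀ A B k]

/-- **`hasDerivAt_covPert_expChartAt₂_snd_zero` — `∂_r|₀(Δ^{U_{0,r}} − Δ^1)^{(k)} = P(−iB·e^{θ₀}) + P(−iB·e^{θ₀})ᴴ + diag(−nΣ_ν(iB_ν)(e^{θ₀,ν} − e^{−θ₀,ν}))`** (the swap
in `hasDerivAt_covPert_expChartAt₂_fst` at `0`): the hypothesis `h01` of PART 251 at the base point. [folklore] -/
theorem hasDerivAt_covPert_expChartAt₂_snd_zero (A₀ A B : (k : ℕ) → Fin d → (idx L M k → ℝ)) (k : ℕ) :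
    HasDerivAt (fun r : ℝ => covPert L M (fun k' ν' (x' : idx L M k') => Complex.exp (Complex.I * (A₀ k' ν' x' : ℂ) / ((lev L k' : ℕ) : ℂ) + (Complex.I * (A k' ν' x' : ℂ) / ((lev L k' : ℕ) : ℂ)) * ((0 : ℝ) : ℂ) + (Complex.I * (B k' ν' x' : ℂ) / ((lev L k' : ℕ) : ℂ)) * (r : ℂ))) k)
      (Pmodel L M (fun k' ν' (x' : idx L M k') => -(Complex.I * (B k' ν' x' : ℂ)) * Complex.exp (Complex.I * (A₀ k' ν' x' : ℂ) / ((lev L k' : ℕ) : ℂ))) k + (Pmodel L M (fun k' ν' (x' : idx L M k') => -(Complex.I * (B k' ν' x' : ℂ)) * Complex.exp (Complex.I * (A₀ k' ν' x' : ℂ) / ((lev L k' : ℕ) : ℂ))) k)ᴴ + Matrix.diagonal (fun x' : idx L M k => -((lev L k : ℕ) : ℂ) * ∑ ν, (Complex.I * (B k ν x' : ℂ)) * (Complex.exp (Complex.I * (A₀ k ν x' : ℂ) / ((lev L k : ℕ) : ℂ)) - Complex.exp (-(Complex.I * (A₀ k ν x' : ℂ) / ((lev L k : ℕ) : ℂ))))))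 0 := by
  have e : (fun r : ℝ => covPert L M (fun k' ν' (x' : idx L M k') => Complex.exp (Complex.I * (A₀ k' ν' x' : ℂ) / ((lev L k' : ℕ) : ℂ) + (Complex.I * (A k' ν' x' : ℂ) / ((lev L k' : ℕ) : ℂ)) * ((0 : ℝ) : ℂ) + (Complex.I * (B k' ν' x' : ℂ) / ((lev L k' : ℕ) : ℂ)) * (r : ℂ))) k)
      = fun r : ℝ => covPert L M (fun k' ν' (x' : idx L M k') => Complex.exp (Complex.I * (A₀ k' ν' x' : ℂ) / ((lev L k' : ℕ) : ℂ) + (Complex.I * (B k' ν' x' : ℂ) / ((lev L k' : ℕ) : ℂ)) * (r : ℂ)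
        + (Complex.I * (A k' ν' x' : ℂ) / ((lev L k' : ℕ) : ℂ)) * ((0 : ℝ) : ℂ))) k :=
    funext fun r => by rw [expChartAt₂_swap L M A₀ A B 0 r]
  rw [e, ← mixedLetter_base_fst_zero L M A₀ B A k]
  exact hasDerivAt_covPert_expChartAt₂_fst L M A₀ B A 0 k

end Letters

end Summit.QuantumFields.BalabanUV.Beta.GAN24.ExponentialChartBaseMixedJets

end
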